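import Mathlib
import Summits.Ventures.HodgeRepro.Tier4.Line1.RTFSetting
import Summits.Ventures.HodgeRepro.Tier4.Line1.KernelSupportFinite
import Summits.Ventures.HodgeRepro.Tier4.Line1.KernelUnfold
import Summits.Ventures.HodgeRepro.Tier4.Line1.KernelOperator

/-!
# Tier4/Line1/KernelAdjointInner — the adjoint of the kernel operator on `S.inner`: `⟨K_f ψ, w⟩ = ⟨ψ, K_{f*} w⟩`

Blind re-derivation cell `pub-hodge-repro`, Tier 4 «prove the step» (README §9–§10), seat t4-L4-p1 (cross-line J1 glue,
lead S12599).  Tree path `lean/Summits/Ventures/HodgeRepro/Tier4/Line1/KernelAdjointInner.lean` (t4-L1-p4 holds `KernelAdjoint.lean`, the operator half).  Mathlib-level; no literature.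

WHAT IS PROVED.  With `f* := cj (refl f)` (`f*(g) = conj f(g⁻¹)`, a test function by `IsTest.refl`/`IsTest.cj`): the
kernel symmetry `conj (K_f x z) = K_{f*} z x` (`kernel_conj`; re-index the rational sum by `γ ↦ γ⁻¹`), and the ADJOINT
identity for `ψ, w ∈ L²(DG)`: `S.inner (K_f ψ) w = S.inner ψ (K_{f*} w)` (`inner_kernelOp_left`; Fubini on `DG × DG`
— the kernel is bounded on `closure DG × closure DG`, `ψ ⊗ w` is integrable on the product of the finite measures).
This is what makes the orthogonal complement of a closed `R`-stable subspace `R`-stable: the step of J1's assembly that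
needs no eigenvalue.

HC_CM is NOT proved by anyone in this repository.
-/

set_option autoImplicit false

noncomputable section

namespace Summit.Ventures.HodgeRepro.Tier4.Line1

open MeasureTheory Topology
open scoped ComplexConjugate

namespace RTF

variable {G : Type} [Group G] [TopologicalSpace G] [IsTopologicalGroup G] [MeasurableSpace G]
  [BorelSpace G]

namespace Setting

variable (S : Setting G)

omit [IsTopologicalGroup G] [BorelSpace G] in
/-- **Kernel symmetry**: `conj (K_f x z) = K_{f*} z x` with `f* = cj (refl f)`. -/
theorem kernel_conj (f : G → ℂ) (x z : G) : conj (S.kernel f x z) = S.kernel (cj (refl f)) z x := by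
  unfold kernel cj refl
  rw [← Complex.star_def, tsum_star, ← (Equiv.inv S.Gk).tsum_eq]
  refine tsum_congr fun γ => ?_
  simp only [Equiv.inv_apply, Complex.star_def, Subgroup.coe_inv]
  congr 2
  group

omit [IsTopologicalGroup G] [BorelSpace G] in
/-- `conj (K_{f*} z x) = K_f x z`. -/
theorem kernel_conj' (f : G → ℂ) (x z : G) : conj (S.kernel (cj (refl f)) z x) = S.kernel f x z := by
  rw [← kernel_conj, Complex.conj_conj]

/-- The product integrand `K_f(x, z) · ψ(z) · conj w(x)` is integrable on `DG × DG`. -/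
theorem integrable_kernel_prod [SecondCountableTopology G] {f : G → ℂ} (hf : IsTest f) {ψ w : G → ℂ}
    (hψ : MemLp ψ 2 (S.μ.restrict S.DG)) (hw : MemLp w 2 (S.μ.restrict S.DG)) :
    Integrable (fun p : G × G => S.kernel f p.1 p.2 * (ψ p.2 * conj (w p.1)))
      ((S.μ.restrict S.DG).prod (S.μ.restrict S.DG)) := by
  haveI := S.isFiniteMeasure_restrict_DG
  obtain ⟨M, hM0, hM⟩ := S.exists_kernel_bound hf
  have hψ1 : Integrable ψ (S.μ.restrict S.DG) := hψ.integrable one_le_two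
  have hw1 : Integrable (fun x => conj (w x)) (S.μ.restrict S.DG) := by
    have := (hw.star).integrable one_le_two
    exact this
  have hprod : Integrable (fun p : G × G => conj (w p.1) * ψ p.2) ((S.μ.restrict S.DG).prod (S.μ.restrict S.DG)) :=
    hw1.mul_prod hψ1
  have hprod' : Integrable (fun p : G × G => ψ p.2 * conj (w p.1)) ((S.μ.restrict S.DG).prod (S.μ.restrict S.DG)) := by
    refine hprod.congr (Filter.Eventually.of_forall fun p => ?_)
    ring
  refine hprod'.bdd_mul (c := M) ((S.kernel_continuous hf).aestronglyMeasurable) ?_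
  have hs : MeasurableSet {p : G × G | ‖S.kernel f p.1 p.2‖ ≤ M} :=
    (isClosed_le (S.kernel_continuous hf).norm continuous_const).measurableSet
  rw [show (∀ᵐ p ∂(S.μ.restrict S.DG).prod (S.μ.restrict S.DG), ‖S.kernel f p.1 p.2‖ ≤ M) ↔
      ∀ᵐ p ∂(S.μ.restrict S.DG).prod (S.μ.restrict S.DG), p ∈ {p : G × G | ‖S.kernel f p.1 p.2‖ ≤ M} from Iff.rfl,
    Measure.ae_prod_mem_iff_ae_ae_mem hs]
  filter_upwards [ae_restrict_mem₀ S.fdG.nullMeasurableSet] with x hx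
  filter_upwards [ae_restrict_mem₀ S.fdG.nullMeasurableSet] with z hz
  exact hM x (subset_closure hx) z (subset_closure hz)

/-- **The adjoint identity**: `S.inner (K_f ψ) w = S.inner ψ (K_{f*} w)` for `ψ, w ∈ L²(DG)`, `f* = cj (refl f)`. -/
theorem inner_kernelOp_left [SecondCountableTopology G] {f : G → ℂ} (hf : IsTest f) {ψ w : G → ℂ}
    (hψ : MemLp ψ 2 (S.μ.restrict S.DG)) (hw : MemLp w 2 (S.μ.restrict S.DG)) :
    S.inner (S.kernelOp f ψ) w = S.inner ψ (S.kernelOp (cj (refl f)) w) := by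
  haveI := S.isFiniteMeasure_restrict_DG
  have hint := S.integrable_kernel_prod hf hψ hw
  have hL : S.inner (S.kernelOp f ψ) w =
      ∫ x, ∫ z, S.kernel f x z * (ψ z * conj (w x)) ∂(S.μ.restrict S.DG) ∂(S.μ.restrict S.DG) := by
    unfold inner kernelOp
    refine integral_congr_ae (Filter.Eventually.of_forall fun x => ?_)
    dsimp only
    rw [← integral_mul_const]
    refine integral_congr_ae (Filter.Eventually.of_forall fun z => ?_)
    ring
  have hR : S.inner ψ (S.kernelOp (cj (refl f)) w) =
      ∫ z, ∫ x, S.kernel f x z * (ψ z * conj (w x)) ∂(S.μ.restrict S.DG) ∂(S.μ.restrict S.DG) := by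
    unfold inner kernelOp
    refine integral_congr_ae (Filter.Eventually.of_forall fun z => ?_)
    dsimp only
    rw [← integral_conj, ← integral_const_mul]
    refine integral_congr_ae (Filter.Eventually.of_forall fun x => ?_)
    dsimp only
    rw [map_mul, kernel_conj']
    ring
  rw [hL, hR]
  exact integral_integral_swap (f := fun x z => S.kernel f x z * (ψ z * conj (w x))) hint

end Setting

end RTF

end Summit.Ventures.HodgeRepro.Tier4.Line1

end
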